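import Summits.FinalStateConjecture.FinalStateConjecture.Theorems.StarvedNecksGapDecaySufficesRelabelPullbackNorms

/-!
# Route StarvedNecks — crux `GapDecaySuffices` (stmt-FinalStateConjecture-18060), line `Sketch`:
# parity-relabel bricks (2/3) for the assembly stub `stub_assembly`: the orientation-reversing
# parity datum `holeDatum Λ`

For a motion `Λ` we construct the `η`-reflection `Q = 1 ⊕ Q̄` of `E4` (`axisRefl u`, `u = Λ⁻¹ ∂₀`), `Q̄ ∈ O(3)`
the mirror across the plane spanned by the spin axis `∂₃` and the spatial part of `u`:
`Q ∈ O(1,3)`, `Q² = 1`, `det Q = −1`, `Q ∂₀ = ∂₀`, `Q u = u`, `(Q v)⁰ = v⁰`, `(Q v)³ = v³`, `‖Q v‖ = ‖v‖`.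
Packaged as the parity datum `holeDatum Λ : ParityDatum Λ` of file (1/3); its lab-frame conjugate
`L = Λ Q Λ⁻¹ = DQ̃` has `det L = −1` (`det_labRefl_holeDatum`), so precomposition with `Q̃` REVERSES the
orientation of a hole chart while keeping its image, its clock/radius sets and all its `Cᵏ` deviation norms
(file 3/3) — the parity step of `CertificateAfterRelabelling`.

Mathlib (`Submodule.reflection`, `Submodule.det_reflection`) + file (1/3); no named facts, no `sorry`.
References: O'Neill 1983, Ch. 9 (Lorentz group).
-/

noncomputable section

open scoped Manifold ContDiff Topology ENNReal RealInnerProductSpace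
open Filter Set Function Topology Literature.Geometry.Lorentzian

namespace Summit.FinalStateConjecture.FinalStateConjecture.Theorems.GapDecaySuffices.Relabel

set_option linter.dupNamespace false

/-! ## The spatial reflection `Q = 1 ⊕ Q̄` adapted to a rest-frame velocity `u` -/

/-- The normal of the reflecting hyperplane: a nonzero vector of the `(x¹, x²)`-plane, Euclidean-orthogonal
to `u` (so the hyperplane contains `∂₀`, `∂₃` and `u`). [folklore] -/
def reflNormal (u : E4) : E4 :=
  if u 1 = 0 ∧ u 2 = 0 then E4.basisVector 1 else (-(u 2)) • E4.basisVector 1 + (u 1) • E4.basisVector 2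

/-- `n⁰ = 0`. [folklore] -/
theorem reflNormal_apply_zero (u : E4) : reflNormal u 0 = 0 := by
  unfold reflNormal; split_ifs <;> simp

/-- `n³ = 0`. [folklore] -/
theorem reflNormal_apply_three (u : E4) : reflNormal u 3 = 0 := by
  unfold reflNormal; split_ifs <;> simp [show (3 : Fin 4) ≠ 1 by decide, show (3 : Fin 4) ≠ 2 by decide]

/-- `n¹`. [folklore] -/
theorem reflNormal_apply_one (u : E4) :
    reflNormal u 1 = if u 1 = 0 ∧ u 2 = 0 then 1 else -(u 2) := by
  unfold reflNormal; split_ifs <;> simp [show (1 : Fin 4) ≠ 2 by decide]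

/-- `n²`. [folklore] -/
theorem reflNormal_apply_two (u : E4) :
    reflNormal u 2 = if u 1 = 0 ∧ u 2 = 0 then 0 else u 1 := by
  unfold reflNormal; split_ifs <;> simp [show (2 : Fin 4) ≠ 1 by decide]

/-- `n ≠ 0`. [folklore] -/
theorem reflNormal_ne_zero (u : E4) : reflNormal u ≠ 0 := by
  intro h
  have h1 := congrArg (fun v : E4 ↦ v 1) h
  have h2 := congrArg (fun v : E4 ↦ v 2) h
  simp only [reflNormal_apply_one, reflNormal_apply_two, PiLp.zero_apply] at h1 h2
  split_ifs at h1 h2 with h0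
  · exact one_ne_zero h1
  · exact h0 ⟨h2, neg_eq_zero.1 h1⟩

/-- `⟪n, v⟫ = n¹ v¹ + n² v²` for the normal `n = reflNormal u`. [folklore] -/
theorem inner_reflNormal (u v : E4) : ⟪reflNormal u, v⟫ = reflNormal u 1 * v 1 + reflNormal u 2 * v 2 := by
  have h : ∀ u' : E4, ⟪u', v⟫ = u' 0 * v 0 + u' 1 * v 1 + u' 2 * v 2 + u' 3 * v 3 := fun u' ↦ by
    simp only [PiLp.inner_apply, RCLike.inner_apply, conj_trivial, Fin.sum_univ_four]; ring
  rw [h, reflNormal_apply_zero, reflNormal_apply_three]; ring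

/-- `⟪n, u⟫ = 0`: `u` lies in the mirror. [folklore] -/
theorem inner_reflNormal_self (u : E4) : ⟪reflNormal u, u⟫ = 0 := by
  rw [inner_reflNormal, reflNormal_apply_one, reflNormal_apply_two]
  split_ifs with h
  · rw [h.1]; ring
  · ring

/-- **The reflection `Q`** across the hyperplane `(reflNormal u)ᗮ ∋ ∂₀, ∂₃, u` (a Euclidean linear isometry of
`E4`; O'Neill 1983, Ch. 9). [folklore] -/
def axisRefl (u : E4) : E4 ≃ₗᵢ[ℝ] E4 := (ℝ ∙ reflNormal u)ᗮ.reflection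

/-- Householder formula for `Q`. [folklore] -/
theorem axisRefl_apply (u v : E4) :
    axisRefl u v = v - 2 • (⟪reflNormal u, v⟫ / ‖reflNormal u‖ ^ 2) • reflNormal u := by
  rw [axisRefl, Submodule.reflection_orthogonal_apply, Submodule.reflection_singleton_apply]
  simp only [RCLike.ofReal_real_eq_id, id_eq, neg_sub]

/-- Householder formula for `Q`, coordinatewise. [folklore] -/
theorem axisRefl_apply_coord (u v : E4) (μ : Fin 4) :
    axisRefl u v μ = v μ - 2 * (⟪reflNormal u, v⟫ / ‖reflNormal u‖ ^ 2) * reflNormal u μ := by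
  rw [axisRefl_apply, two_smul]
  simp only [PiLp.sub_apply, PiLp.add_apply, PiLp.smul_apply, smul_eq_mul]; ring

/-- `(Q v)⁰ = v⁰`. [folklore] -/
@[simp] theorem axisRefl_apply_zero (u v : E4) : axisRefl u v 0 = v 0 := by
  rw [axisRefl_apply_coord, reflNormal_apply_zero]; ring

/-- `(Q v)³ = v³`. [folklore] -/
@[simp] theorem axisRefl_apply_three (u v : E4) : axisRefl u v 3 = v 3 := by
  rw [axisRefl_apply_coord, reflNormal_apply_three]; ring

/-- `Q² = 1`. [folklore] -/
theorem axisRefl_axisRefl (u v : E4) : axisRefl u (axisRefl u v) = v :=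
  Submodule.reflection_reflection _ v

/-- `Q u = u`: the rest-frame velocity lies in the mirror. [folklore] -/
theorem axisRefl_self (u : E4) : axisRefl u u = u := by
  refine Submodule.reflection_mem_subspace_eq_self ?_
  rw [Submodule.mem_orthogonal_singleton_iff_inner_right, inner_reflNormal_self]

/-- `Q ∂₀ = ∂₀`. [folklore] -/
theorem axisRefl_basisVector_zero (u : E4) : axisRefl u (E4.basisVector 0) = E4.basisVector 0 := by
  refine Submodule.reflection_mem_subspace_eq_self ?_
  rw [Submodule.mem_orthogonal_singleton_iff_inner_right, inner_reflNormal]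
  simp

/-- `det Q = −1`: `Q` reverses orientation. [folklore] -/
theorem det_axisRefl (u : E4) :
    LinearMap.det (axisRefl u).toLinearEquiv.toLinearMap = -1 := by
  rw [axisRefl, Submodule.det_reflection, Submodule.orthogonal_orthogonal,
    finrank_span_singleton (reflNormal_ne_zero u), pow_one]

/-- `Q ∈ O(1,3)`: `Q` preserves `η` (it is Euclidean-orthogonal and fixes the time coordinate). [folklore] -/
theorem minkowski_bilin_axisRefl (u v w : E4) :
    Minkowski.bilin (axisRefl u v) (axisRefl u w) = Minkowski.bilin v w := by
  rw [minkowski_bilin_eq_inner_sub, minkowski_bilin_eq_inner_sub, (axisRefl u).inner_map_map,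
    axisRefl_apply_zero, axisRefl_apply_zero]

/-- `Q` as an element of the Lorentz group `lorentzGroup ≤ (E4 ≃L[ℝ] E4)`. [folklore] -/
def axisReflL (u : E4) : lorentzGroup :=
  ⟨(axisRefl u).toContinuousLinearEquiv, fun v w ↦ minkowski_bilin_axisRefl u v w⟩

/-- `axisReflL` is `axisRefl`. [folklore] -/
@[simp] theorem axisReflL_apply (u v : E4) : ((axisReflL u : lorentzGroup) : E4 ≃L[ℝ] E4) v = axisRefl u v := rfl

/-! ## The orientation-reversing parity datum of a motion -/

/-- The rest-frame four-velocity direction `u = Λ⁻¹ ∂₀` of the motion `Λ`. [folklore] -/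
def restVel (Λ : lorentzGroup) : E4 := (Λ : E4 ≃L[ℝ] E4).symm (E4.basisVector 0)

/-- **The hole reflection datum** `Q_Λ := axisReflL (Λ⁻¹ ∂₀)` (rest-frame coordinates). [folklore] -/
def holeDatum (Λ : lorentzGroup) : ParityDatum Λ where
  Q := axisReflL (restVel Λ)
  apply_apply := axisRefl_axisRefl _
  map_basisVector_zero := axisRefl_basisVector_zero _
  map_restVel := axisRefl_self _
  apply_three := axisRefl_apply_three _

/-- `(holeDatum Λ).Q` is `axisRefl (restVel Λ)`. [folklore] -/
@[simp] theorem holeDatum_Q_apply (Λ : lorentzGroup) (v : E4) :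
    (((holeDatum Λ).Q : lorentzGroup) : E4 ≃L[ℝ] E4) v = axisRefl (restVel Λ) v := rfl

/-- `det Q_Λ = −1`. [folklore] -/
theorem det_holeDatum (Λ : lorentzGroup) :
    LinearMap.det ((((holeDatum Λ).Q : lorentzGroup) : E4 ≃L[ℝ] E4) : E4 →ₗ[ℝ] E4) = -1 :=
  det_axisRefl (restVel Λ)

/-- `det 1 = 1` for the trivial datum. [folklore] -/
theorem det_oneDatum (Λ : lorentzGroup) :
    LinearMap.det ((((oneDatum Λ).Q : lorentzGroup) : E4 ≃L[ℝ] E4) : E4 →ₗ[ℝ] E4) = 1 :=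
  LinearMap.det_id

section Det

variable {Λ : lorentzGroup} (P : ParityDatum Λ)

/-- `det L = det Q` (conjugation invariance). [folklore] -/
theorem det_labRefl :
    LinearMap.det (((labRefl P : lorentzGroup) : E4 ≃L[ℝ] E4) : E4 →ₗ[ℝ] E4) =
      LinearMap.det (((P.Q : lorentzGroup) : E4 ≃L[ℝ] E4) : E4 →ₗ[ℝ] E4) := by
  have h : (((labRefl P : lorentzGroup) : E4 ≃L[ℝ] E4) : E4 →ₗ[ℝ] E4) =
      ((Λ : E4 ≃L[ℝ] E4) : E4 →ₗ[ℝ] E4) ∘ₗ (((P.Q : lorentzGroup) : E4 ≃L[ℝ] E4) : E4 →ₗ[ℝ] E4) ∘ₗ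
        ((Λ : E4 ≃L[ℝ] E4).symm : E4 →ₗ[ℝ] E4) := by
    ext v : 1; rfl
  rw [h, LinearMap.det_comp, LinearMap.det_comp, mul_comm, mul_assoc, ← LinearMap.det_comp]
  have h2 : ((Λ : E4 ≃L[ℝ] E4).symm : E4 →ₗ[ℝ] E4) ∘ₗ ((Λ : E4 ≃L[ℝ] E4) : E4 →ₗ[ℝ] E4) = LinearMap.id := by
    ext v : 1; simp
  rw [h2, LinearMap.det_id, mul_one]

end Det

/-- **The lab-frame differential `DQ̃ = L` of the hole reflection reverses orientation**: `det L = −1`. [folklore] -/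
theorem det_labRefl_holeDatum (Λ : lorentzGroup) :
    LinearMap.det (((labRefl (holeDatum Λ) : lorentzGroup) : E4 ≃L[ℝ] E4) : E4 →ₗ[ℝ] E4) = -1 := by
  rw [det_labRefl, det_holeDatum]

/-- … while for the trivial datum `det L = 1`. [folklore] -/
theorem det_labRefl_oneDatum (Λ : lorentzGroup) :
    LinearMap.det (((labRefl (oneDatum Λ) : lorentzGroup) : E4 ≃L[ℝ] E4) : E4 →ₗ[ℝ] E4) = 1 := by
  rw [det_labRefl, det_oneDatum]

/-- `det DQ̃ = −1` at every point, for the hole reflection. [folklore] -/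
theorem det_fderiv_reflAffine_holeDatum (Λ : lorentzGroup) (c x : E4) :
    LinearMap.det (fderiv ℝ (reflAffine (holeDatum Λ) c) x : E4 →ₗ[ℝ] E4) = -1 := by
  rw [fderiv_reflAffine]
  exact det_labRefl_holeDatum Λ


/-- **Registered brick `stub_parityReflection`** (line `Sketch` of crux stmt-FinalStateConjecture-18060): every
motion `Λ` admits an ORIENTATION-REVERSING parity involution — a Lorentz `Q` with `Q² = 1`, `Q ∂₀ = ∂₀`,
`Q (Λ⁻¹∂₀) = Λ⁻¹∂₀`, `(Q v)³ = v³`, `‖Q v‖ = ‖v‖`, `det Q = −1` (the mirror `holeDatum Λ`). [folklore] -/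
theorem stub_parityReflection (Λ : lorentzGroup) :
    ∃ Q : lorentzGroup, (∀ v, (Q : E4 ≃L[ℝ] E4) ((Q : E4 ≃L[ℝ] E4) v) = v) ∧
      (Q : E4 ≃L[ℝ] E4) (E4.basisVector 0) = E4.basisVector 0 ∧
      (Q : E4 ≃L[ℝ] E4) ((Λ : E4 ≃L[ℝ] E4).symm (E4.basisVector 0)) =
        (Λ : E4 ≃L[ℝ] E4).symm (E4.basisVector 0) ∧
      (∀ v, (Q : E4 ≃L[ℝ] E4) v 3 = v 3) ∧ (∀ v, ‖(Q : E4 ≃L[ℝ] E4) v‖ = ‖v‖) ∧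
      LinearMap.det ((Q : E4 ≃L[ℝ] E4) : E4 →ₗ[ℝ] E4) = -1 :=
  ⟨(holeDatum Λ).Q, (holeDatum Λ).apply_apply, (holeDatum Λ).map_basisVector_zero, (holeDatum Λ).map_restVel,
    (holeDatum Λ).apply_three, (holeDatum Λ).norm_map, det_holeDatum Λ⟩

end Summit.FinalStateConjecture.FinalStateConjecture.Theorems.GapDecaySuffices.Relabel

end
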